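import Summits.QuantumFields.BalabanUV.Beta.GAN24.WoodburyFibreAssembly
import Summits.QuantumFields.BalabanUV.Beta.GAN24.KSlotAssembly

/-!
# Beta / GAN24 / WoodburyFibreClosed — P3's located residual `FieldBlocksRate` HOLDS, by name, from road P1's END node

Cell `pub-balaban`, β sub-cell, BINDER ROW **G-an2-4 ∕ (CONV-C)** («non-abelian one-step η-rate comparison of the constituent
kernels `(G_k, H_k, C^{(k)})` at `U = 1` — NOT IN PRINT; our proof»), prover part **P3 = WOODBURY-FIBRE reduction** (lineage
`b2b-balaban-gan24-p3`, gen 5; census `HOME/b2b-balaban-gan24-p3/WOODBURY-FIBRE.md` v4, row (d) = V4 = V7).  HONEST FRAMING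
(verbatim): discharging `BetaPertH` makes Bałaban's UV stability UNCONDITIONAL — a real constructive-QFT result; it is NOT the
continuum limit and NOT the Clay problem.  HONEST DEPENDENCY: continuum YM on T⁴ ⇐ BetaPertH ∧ nine spine estimates (0/9 proved);
BetaPertH ⇐ (D1) ∧ (D4) ∧ CAP+tail; G-an2-4 gates asym, D1 and NE2/3/4.

WHAT THIS FILE SAYS.  The P3 census split the resolvent third `ConvCResolvent` of (CONV-C) into the multiplier block (closed
unconditionally in gen 3: `WoodburyFibreAssembly.decays_blockMM(_sub)`) and ONE typed residual, the field-block estimate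
`WoodburyFibre.FieldBlocksRate Lc C δK cK θ` on the `FF + FM + MF` legs of the one-step-normalised resolvents `K_j^{(1)}`, and proved
`ConvCKWall 3 Lc ↔ ∃ (C, δK > 0, cK, 0 ≤ θ < 1), FieldBlocksRate` (`convCKWall_iff_exists_fieldBlocksRate`).  Road P1's END node
`KSlotAssembly.convCK_holds (hLc : 2 ≤ Lc) : ConvCK 3 Lc` (swarm `b2b-balaban-gan24-formalise-*`, p204341; (I3′) `FibreStrip.fibreStrip`
∧ (I2′) `FibreRate.realRateK`) is now in the tree, so the residual HOLDS for every `Lc ≥ 2` — by name, through P3's own socket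
`WoodburyFibreAssembly.exists_fieldBlocksRate_of_convCK`.  Nothing of P3's is an estimate here; `[folklore]` bookkeeping, 0 sorry.
HONEST: this closes the P3 census row (d)=V4=V7 («K-slot = field-block residual»), i.e. 2 of an2's 4 binder families (hK, hKall)
in P3's currency; it is NOT «G-an2-4 closed» (S-slot `hS`/`hSall` and W-slot remain, `HOME/b2b-balaban-gan24-p1/S-SLOT.md`), 0 wall
binders are instantiated at a value here, NOT `BetaPertH`, NOT continuum, NOT Clay.
-/

namespace Summit.QuantumFields.BalabanUV.Beta.GAN24.WoodburyFibreClosed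

open Literature.MathematicalPhysics.QuantumFieldTheory.Balaban1983to89.Beta
open ExpKernelCalculus (Decays)
open Summit.QuantumFields.BalabanUV.Beta.PropagatorWoodburyFibreTarget (unitResolvent)
open Summit.QuantumFields.BalabanUV.Beta.GAN24.WoodburyFibre (FieldBlocksRate)
open Summit.QuantumFields.BalabanUV.Beta.GAN24.WoodburyFibreBlocks (blockF)
open Summit.QuantumFields.BalabanUV.Beta.GAN24.WoodburyFibreAssembly (exists_fieldBlocksRate_of_convCK)

variable {Lc : ℕ} [NeZero Lc]

/-- **P3's RESIDUAL HOLDS** (census row (d) = V4 = V7 CLOSED BY NAME): for every `Lc ≥ 2` there are constants `C`, `δK > 0`, `cK`,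
`0 ≤ θ < 1` with `FieldBlocksRate Lc C δK cK θ` — road P1's `KSlotAssembly.convCK_holds` through P3's socket
`exists_fieldBlocksRate_of_convCK`. [folklore] -/
theorem fieldBlocksRate_holds (hLc : 2 ≤ Lc) :
    ∃ C δK cK θ : ℝ, 0 < δK ∧ 0 ≤ θ ∧ θ < 1 ∧ FieldBlocksRate Lc C δK cK θ :=
  exists_fieldBlocksRate_of_convCK hLc (KSlotAssembly.convCK_holds hLc)

/-- The same, unfolded to the two rows of the census: `j`-uniform decay of the field blocks of `K_j^{(1)}` and their all-scales
geometric rate. [folklore] -/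
theorem fieldBlocks_rows_holds (hLc : 2 ≤ Lc) :
    ∃ C δK cK θ : ℝ, 0 < δK ∧ 0 ≤ θ ∧ θ < 1 ∧ (∀ j, Decays (blockF (unitResolvent Lc j)) C δK) ∧
      ∀ k j, Decays (blockF (unitResolvent Lc (k + j)) - blockF (unitResolvent Lc k)) (cK * θ ^ k) δK := by
  obtain ⟨C, δK, cK, θ, hδ, hθ0, hθ1, h1, h2⟩ := fieldBlocksRate_holds (Lc := Lc) hLc
  exact ⟨C, δK, cK, θ, hδ, hθ0, hθ1, h1, h2⟩

end Summit.QuantumFields.BalabanUV.Beta.GAN24.WoodburyFibreClosed
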